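import Summits.ValiantsHypothesis.ValiantsHypothesis.Theses.ShallowShadows
import Summits.ValiantsHypothesis.ValiantsHypothesis.Theorems.ShadowFormulaTransfer.Negative.FalseWithoutZeroOne
import Literature.Barriers.ValiantsHypothesis.CharacteristicTwoProofs
import Literature.Computability.AlgebraicComplexity.PermanentIrreducible
import Literature.Computability.AlgebraicComplexity.StandardFamiliesProofs
import Literature.Computability.AlgebraicComplexity.DeterminantalComplexity
import Literature.Computability.Complexity.KWProtocolFormula

/-!
# Crux `ShadowFormulaTransfer` (stmt-ValiantsHypothesis-17124): the field is load-bearing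

Negative lemmas for the crux X = `ShadowFormulaTransfer` of route `ShallowShadows`
(refuter / cdisprove, cycle 1; companion of `Negative/FalseWithoutZeroOne.lean`, p152518, which
treats the `0/1` and `VP` hypotheses). Everything is modulo the route's far side
`RazWigdersonMatching` (Raz–Wigderson 1992, an open formalisation item), the only lower bound on
`formulaSizeOver monotoneBasis` strong enough to beat the window `2^{d^{1-δ}(log(n+2))^C + C}`.

* §0 `shadow_perPoly_eq` — over ANY nontrivial commutative semiring the shadow (Boolean version)
  of `per_m` is `perfectMatchingFn m`, and `coeff_perPoly_eq_zero_or_one` — its coefficients are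
  `0/1` over any semiring; `totalDegree_perPoly_fin`.
* §0' `no_window_bound_of_razWigderson` (with the landed `Negative.eventually_window`) — the analytic contradiction of the
  deciding theorem `closes`, isolated: given RW92, `PM_n` has no eventual bound of window shape.
* §1 **`shadowFormulaTransfer_false_over_charP_two`**: for every field `k` of characteristic 2,
  `RazWigdersonMatching → ¬ (X stated over k)` — witness `per_n = det_n ∈ VP_k`
  (tree `isVPFamily_perPoly_of_charTwo_of_commRing`), 0/1 coefficients, shadow `PM_n`, degree n.
  Moral: together with p152518 (det over ℂ: coefficients `{0,±1}`; per over ℂ: not known VP) the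
  three objects det_ℂ, per_ℂ, per_{𝔽₂} have the SAME shadow `PM_n`; X survives each only by one
  hypothesis (0/1, VP, char 0 respectively). Any proof of X must use cheapness, sign-coherence
  AND positivity of `ℂ` (that `-1 ∉ {0,1}`) jointly — the `PermanentCharTwo` barrier made formal
  for this crux: no support- or rank-only argument can prove X.
* §2 `pointwise_of_shadowFormulaTransfer` (δ, C may depend on the family) and
  `not_isVPFamily_per_of_pointwise`: the pointwise form
  already yields `per ∉ VP_ℂ` from RW92, i.e. carries the full deciding power used by `closes`;
  by a padding/diagonalisation argument (docstring) the two forms are in fact equivalent.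
-/

namespace Summit.ValiantsHypothesis.ValiantsHypothesis.Theorems.ShadowFormulaTransfer.Negative.FalseOverCharTwo

set_option linter.dupNamespace false

open Literature.Computability.AlgebraicComplexity Literature.Computability.Complexity
open Literature.Barriers.PneNP MvPolynomial Filter
open Summit.ValiantsHypothesis.ValiantsHypothesis.Theses.ShallowShadows

/-! ## §0 The shadow of the permanent over an arbitrary nontrivial semiring -/

section PerShadow

variable (k : Type*) [CommSemiring k]

/-- Over ANY commutative semiring every coefficient of `per_m` is `0` or `1` (distinct
permutations have distinct monomials). [folklore] -/
theorem coeff_perPoly_eq_zero_or_one {m : ℕ} (d : Fin m × Fin m →₀ ℕ) :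
    (perPoly (Fin m) k).coeff d = 0 ∨ (perPoly (Fin m) k).coeff d = 1 := by
  by_cases h : ∃ ρ : Equiv.Perm (Fin m), permMonomial ρ = d
  · obtain ⟨ρ, rfl⟩ := h
    exact Or.inr (coeff_permMonomial_perPoly k ρ)
  · left
    by_contra hne
    exact h (exists_permMonomial_eq_of_coeff_perPoly_ne_zero k hne)

variable [Nontrivial k]

/-- Support of `per_m` over a nontrivial semiring = permutation monomials. [folklore] -/
theorem mem_support_perPoly_iff {m : ℕ} (mo : Fin m × Fin m →₀ ℕ) :
    mo ∈ (perPoly (Fin m) k).support ↔ ∃ ρ : Equiv.Perm (Fin m), permMonomial ρ = mo := by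
  rw [MvPolynomial.mem_support_iff]
  constructor
  · exact exists_permMonomial_eq_of_coeff_perPoly_ne_zero k
  · rintro ⟨ρ, rfl⟩
    rw [coeff_permMonomial_perPoly]
    exact one_ne_zero

omit [Nontrivial k] in
/-- The cells of a permutation monomial. [folklore] -/
theorem mem_support_permMonomial_iff {m : ℕ} (ρ : Equiv.Perm (Fin m)) (p : Fin m × Fin m) :
    p ∈ (permMonomial ρ).support ↔ ρ p.2 = p.1 := by
  obtain ⟨r, c⟩ := p
  rw [Finsupp.mem_support_iff, permMonomial_apply]
  by_cases h : ρ c = r <;> simp [h]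

/-- The shadow of `per_m` is the bipartite perfect matching predicate. [folklore] -/
theorem shadow_perPoly_iff {m : ℕ} (a : Fin m × Fin m → Bool) :
    (∃ mo ∈ (perPoly (Fin m) k).support, ∀ i ∈ mo.support, a i = true) ↔
      ∃ σ : Equiv.Perm (Fin m), ∀ i, a (i, σ i) = true := by
  constructor
  · rintro ⟨mo, hmo, ha⟩
    obtain ⟨ρ, rfl⟩ := (mem_support_perPoly_iff k mo).1 hmo
    refine ⟨ρ.symm, fun i => ha _ ?_⟩
    rw [mem_support_permMonomial_iff]
    simp
  · rintro ⟨σ, hσ⟩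
    refine ⟨permMonomial σ.symm, (mem_support_perPoly_iff k _).2 ⟨σ.symm, rfl⟩, ?_⟩
    rintro ⟨r, c⟩ hp
    rw [mem_support_permMonomial_iff] at hp
    simp only at hp
    subst hp
    simpa using hσ (σ.symm c)

/-- `B(per_m) = PM_m` as Boolean functions, over any nontrivial semiring. [folklore] -/
theorem shadow_perPoly_eq (m : ℕ) :
    (fun a : Fin m × Fin m → Bool =>
      decide (∃ mo ∈ (perPoly (Fin m) k).support, ∀ i ∈ mo.support, a i = true)) =
      perfectMatchingFn m := by
  funext a
  unfold perfectMatchingFn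
  exact decide_eq_decide.mpr (shadow_perPoly_iff k a)

/-- `deg per_m = m` over a nontrivial semiring (tree fact `totalDegree_perPoly`). [folklore] -/
theorem totalDegree_perPoly_fin (m : ℕ) : (perPoly (Fin m) k).totalDegree = m := by
  rw [(totalDegree_perPoly_holds (n := Fin m) (k := k) : (perPoly (Fin m) k).totalDegree = _),
    Fintype.card_fin]

end PerShadow

/-! ## §0' The analytic window and the Raz–Wigderson contradiction, isolated -/

-- `eventually_window` (the analytic window `x^{1-δ}(log(x+2))^C + C < c·x` eventually) is the
-- landed `Summit.ValiantsHypothesis.ValiantsHypothesis.Theorems.ShadowFormulaTransfer.Negative.eventually_window`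
-- (FalseWithoutZeroOne.lean, p152518), visible here from the enclosing namespace.

/-- Given Raz–Wigderson, `PM_n` admits NO eventual bound of the window shape
`2^{n^{1-δ}(log(n+2))^C + C}` — the contradiction step of `closes`, isolated so that every
witness family with shadow `PM_n` and degree `n` can reuse it. [folklore] -/
theorem no_window_bound_of_razWigderson (hRW : RazWigdersonMatching) {δ : ℝ} (hδ : 0 < δ)
    (C n₀ : ℕ) :
    ¬ ∀ n ≥ n₀, (formulaSizeOver monotoneBasis (perfectMatchingFn n) : ℝ) ≤
        2 ^ ((n : ℝ) ^ (1 - δ) * Real.log (n + 2) ^ C + C) := by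
  intro h
  obtain ⟨c, hc, m₀, hm₀⟩ := hRW
  obtain ⟨N, hN⟩ := eventually_atTop.mp
    ((tendsto_natCast_atTop_atTop (R := ℝ)).eventually (eventually_window δ hδ C c hc))
  let n : ℕ := max (max n₀ m₀) N
  have hb := h n ((le_max_left _ _).trans (le_max_left _ _))
  have hr := hm₀ n ((le_max_right _ _).trans (le_max_left _ _))
  have hw := hN n (le_max_right _ _)
  have hchain := hr.trans hb
  rw [Real.rpow_le_rpow_left_iff (by norm_num : (1 : ℝ) < 2)] at hchain
  linarith

/-! ## §1 Load-bearing: the field. X over a field of characteristic two is false (mod RW92).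

The variant "X over the field `k`" is written out verbatim (the crux with `ℂ ↦ k`); no new
`def : Prop` is introduced in the tree (the named forms `ShadowFormulaTransferOver`,
`ShadowFormulaTransferPointwise` live in the crux workfile `Cruxes/ShadowFormulaTransfer/Disproof.lean`). -/

/-- **Load-bearing (field / positivity).** Over every field `k` of characteristic `2` the
transfer X (stated over `k` instead of `ℂ`) is FALSE modulo Raz–Wigderson: `per_n = det_n ∈ VP_k`
(tree: `isVPFamily_perPoly_of_charTwo_of_commRing`), its coefficients are `0/1`, its shadow is
`PM_n` of monotone formula size `2^{Ω(n)}`, but `deg per_n = n` makes the window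
`2^{n^{1-δ} polylog}`. So any proof of X must use a property of `ℂ` absent in characteristic 2
(that `-1 ∉ {0,1}`, i.e. positivity), not merely supports/ranks — the `PermanentCharTwo` barrier,
made formal for this crux. [folklore] -/
theorem shadowFormulaTransfer_false_over_charP_two (hRW : RazWigdersonMatching)
    (k : Type) [Field k] [CharP k 2] :
    ¬ ∃ δ : ℝ, 0 < δ ∧ ∃ C : ℕ, ∀ (σ : ℕ → Type) [∀ n, Fintype (σ n)] [∀ n, DecidableEq (σ n)]
      (f : ∀ n, MvPolynomial (σ n) k), IsVPFamily f →
      (∀ (n : ℕ) (m : σ n →₀ ℕ), (f n).coeff m = 0 ∨ (f n).coeff m = 1) →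
      ∃ n₀ : ℕ, ∀ n ≥ n₀, (formulaSizeOver monotoneBasis
        (fun a : σ n → Bool => decide (∃ m ∈ (f n).support, ∀ i ∈ m.support, a i = true)) : ℝ)
        ≤ 2 ^ (((f n).totalDegree : ℝ) ^ (1 - δ) * (Real.log (n + 2)) ^ C + C) := by
  rintro ⟨δ, hδ, C, hC⟩
  obtain ⟨n₀, hn₀⟩ := hC (fun n => Fin n × Fin n) (fun n => perPoly (Fin n) k)
    (Literature.Barriers.ValiantsHypothesis.isVPFamily_perPoly_of_charTwo_of_commRing k)
    (fun n mo => coeff_perPoly_eq_zero_or_one k mo)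
  refine no_window_bound_of_razWigderson hRW hδ C n₀ fun n hn => ?_
  have h := hn₀ n hn
  simp only [shadow_perPoly_eq k n, totalDegree_perPoly_fin k n] at h
  exact h

/-- The field-uniform strengthening "X over every field" is false (mod RW92): take `k = 𝔽₂`,
where the 0/1 hypothesis is even vacuous. [folklore] -/
theorem shadowFormulaTransfer_false_forall_field (hRW : RazWigdersonMatching) :
    ¬ ∀ (k : Type) [Field k],
      ∃ δ : ℝ, 0 < δ ∧ ∃ C : ℕ, ∀ (σ : ℕ → Type) [∀ n, Fintype (σ n)] [∀ n, DecidableEq (σ n)]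
      (f : ∀ n, MvPolynomial (σ n) k), IsVPFamily f →
      (∀ (n : ℕ) (m : σ n →₀ ℕ), (f n).coeff m = 0 ∨ (f n).coeff m = 1) →
      ∃ n₀ : ℕ, ∀ n ≥ n₀, (formulaSizeOver monotoneBasis
        (fun a : σ n → Bool => decide (∃ m ∈ (f n).support, ∀ i ∈ m.support, a i = true)) : ℝ)
        ≤ 2 ^ (((f n).totalDegree : ℝ) ^ (1 - δ) * (Real.log (n + 2)) ^ C + C) :=
  fun h => shadowFormulaTransfer_false_over_charP_two hRW (ZMod 2) (h (ZMod 2))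

/-! ## §2 Quantifier strength: the pointwise form suffices for `closes` -/

/-- X ⇒ pointwise X (δ, C depending on the family; trivial direction). The deciding theorem
`closes h1 hRW` uses `h1` only through this consequence (it instantiates at `f = per` first), so
the crux may be weakened to the pointwise form at zero cost to the route. Conversely pointwise
X ⇒ X by diagonalisation (not formalised): if X failed, pick for each j a violating family for
(δ, C) = (1/j, j), pad indices polynomially so that all members satisfy
`complexity, #vars, deg ≤ 2n ≤ n² + 2`, and interleave them into ONE 0/1 VP family, which then
violates every (δ, C). So uniformity of (δ, C) is not an attack surface. [folklore] -/
theorem pointwise_of_shadowFormulaTransfer (h : ShadowFormulaTransfer) :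
    ∀ (σ : ℕ → Type) [∀ n, Fintype (σ n)] [∀ n, DecidableEq (σ n)]
      (f : ∀ n, MvPolynomial (σ n) ℂ), IsVPFamily f →
      (∀ (n : ℕ) (m : σ n →₀ ℕ), (f n).coeff m = 0 ∨ (f n).coeff m = 1) →
      ∃ δ : ℝ, 0 < δ ∧ ∃ C n₀ : ℕ, ∀ n ≥ n₀, (formulaSizeOver monotoneBasis
        (fun a : σ n → Bool => decide (∃ m ∈ (f n).support, ∀ i ∈ m.support, a i = true)) : ℝ)
        ≤ 2 ^ (((f n).totalDegree : ℝ) ^ (1 - δ) * (Real.log (n + 2)) ^ C + C) := by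
  intro σ _ _ f hVP h01
  obtain ⟨δ, hδ, C, hC⟩ := h
  obtain ⟨n₀, hn₀⟩ := hC σ f hVP h01
  exact ⟨δ, hδ, C, n₀, hn₀⟩

/-- The pointwise form already refutes `per ∈ VP_ℂ` given RW92 (so it carries the whole
deciding power the route extracts from the crux). [folklore] -/
theorem not_isVPFamily_per_of_pointwise
    (h : ∀ (σ : ℕ → Type) [∀ n, Fintype (σ n)] [∀ n, DecidableEq (σ n)]
      (f : ∀ n, MvPolynomial (σ n) ℂ), IsVPFamily f →
      (∀ (n : ℕ) (m : σ n →₀ ℕ), (f n).coeff m = 0 ∨ (f n).coeff m = 1) →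
      ∃ δ : ℝ, 0 < δ ∧ ∃ C n₀ : ℕ, ∀ n ≥ n₀, (formulaSizeOver monotoneBasis
        (fun a : σ n → Bool => decide (∃ m ∈ (f n).support, ∀ i ∈ m.support, a i = true)) : ℝ)
        ≤ 2 ^ (((f n).totalDegree : ℝ) ^ (1 - δ) * (Real.log (n + 2)) ^ C + C))
    (hRW : RazWigdersonMatching) :
    ¬ IsVPFamily (fun n => perPoly (Fin n) ℂ) := by
  intro hVP
  obtain ⟨δ, hδ, C, n₀, hn₀⟩ := h (fun n => Fin n × Fin n) (fun n => perPoly (Fin n) ℂ) hVP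
    (fun n mo => coeff_perPoly_eq_zero_or_one ℂ mo)
  refine no_window_bound_of_razWigderson hRW hδ C n₀ fun n hn => ?_
  have h := hn₀ n hn
  simp only [shadow_perPoly_eq ℂ n, totalDegree_perPoly_fin ℂ n] at h
  exact h

/-! ## §3 Line det-kw: the window stub over a field of characteristic two is false (mod RW92)

`stub_detProtocolWindow` (lead reshape 2026-08-17 of `stub_detProtocol`, line `Lines/det_kw.lean`)
is X relocated onto ONE affine symbolic matrix, in monotone-KW-depth form and uniform in the
instance. Over a field of characteristic 2 the SAME statement is false modulo Raz–Wigderson: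
`g = per_M = det_M` has `HasDetRepr g M`, 0/1 coefficients, `M²` variables, degree `M`, its
instance lies in the window for large `M`, and its shadow `PM_M` has no protocol of depth
`< c·M` (RW92 + the landed easy KW direction `KWTree.formulaSizeOver_le_two_pow_depth`).
So a proof of the window stub must use, beyond "small det-representation + 0/1 support",
that over `ℂ` these two are JOINTLY rare (positivity: over `ℂ` the 0/1 pattern `PM_M` is `per`,
over `𝔽₂` it is `det`). -/

/-- **Target (line det-kw), characteristic-2 variant of `stub_detProtocolWindow` is false**
modulo `RazWigdersonMatching`; witness `per_M = det_M` over `k`, `M` large. [folklore] -/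
theorem detProtocolWindow_false_over_charP_two (hRW : RazWigdersonMatching)
    (k : Type) [Field k] [CharP k 2] :
    ¬ ∃ δ : ℝ, 0 < δ ∧ δ < 1 ∧ ∃ C : ℕ, ∀ (ι : Type) [Fintype ι] [Nonempty ι]
      (g : MvPolynomial ι k) (m : ℕ), HasDetRepr g m →
      (∀ mo : ι →₀ ℕ, g.coeff mo = 0 ∨ g.coeff mo = 1) →
      (g.totalDegree : ℝ) ^ (1 - δ) * (Real.log ((m : ℝ) + (Fintype.card ι : ℝ) + 2)) ^ C + C <
        ((min (g.totalDegree * Nat.clog 2 (Fintype.card ι + 1) + Nat.clog 2 (Fintype.card ι))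
          (Fintype.card ι + Nat.clog 2 (Fintype.card ι)) : ℕ) : ℝ) →
      ∃ P : KWTree ι,
        P.SolvesMono (fun a : ι → Bool => decide (∃ mo ∈ g.support, ∀ i ∈ mo.support, a i = true)) ∧
        (P.depth : ℝ) ≤ (g.totalDegree : ℝ) ^ (1 - δ) *
          (Real.log ((m : ℝ) + (Fintype.card ι : ℝ) + 2)) ^ C + C := by
  rintro ⟨δ, hδ, -, C, hC⟩
  obtain ⟨c, hc, m₀, hm₀⟩ := hRW
  have hmin : 0 < min c 1 := lt_min hc one_pos
  have hc₁pos : 0 < min c 1 / 2 ^ (C + 1) := by positivity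
  obtain ⟨N, hN⟩ := eventually_atTop.mp ((tendsto_natCast_atTop_atTop (R := ℝ)).eventually
    (eventually_window δ hδ C (min c 1 / 2 ^ (C + 1)) hc₁pos))
  -- the witness size
  obtain ⟨M, hMm₀, hMN, hM1⟩ : ∃ M : ℕ, m₀ ≤ M ∧ N ≤ M ∧ 1 ≤ M :=
    ⟨max (max m₀ N) 1, (le_max_left _ _).trans (le_max_left _ _),
      (le_max_right _ _).trans (le_max_left _ _), le_max_right _ _⟩
  have hMpos : (0 : ℝ) < M := by exact_mod_cast hM1
  have hw := hN M hMN
  -- instantiate the stub at `per_M = det_M` over `k`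
  haveI : Nonempty (Fin M × Fin M) := ⟨(⟨0, hM1⟩, ⟨0, hM1⟩)⟩
  have hrepr : HasDetRepr (perPoly (Fin M) k) M := by
    rw [perPoly_eq_detPoly_of_charP_two]; exact hasDetRepr_detPoly M
  have hdeg : (perPoly (Fin M) k).totalDegree = M := totalDegree_perPoly_fin k M
  have hcard : Fintype.card (Fin M × Fin M) = M * M := by simp
  have hspec := hC (Fin M × Fin M) (perPoly (Fin M) k) M hrepr
    (fun mo => coeff_perPoly_eq_zero_or_one k mo)
  rw [hdeg, hcard] at hspec
  -- the budget `B` at this instance is `< (min c 1 / 2) · M`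
  set B : ℝ := (M : ℝ) ^ (1 - δ) * Real.log ((M : ℝ) + ((M * M : ℕ) : ℝ) + 2) ^ C + C with hBdef
  have hlog0 : 0 ≤ Real.log ((M : ℝ) + ((M * M : ℕ) : ℝ) + 2) :=
    Real.log_nonneg (by push_cast; nlinarith)
  have hlog : Real.log ((M : ℝ) + ((M * M : ℕ) : ℝ) + 2) ≤ 2 * Real.log ((M : ℝ) + 2) := by
    calc Real.log ((M : ℝ) + ((M * M : ℕ) : ℝ) + 2)
        ≤ Real.log (((M : ℝ) + 2) ^ 2) := by
          apply Real.log_le_log (by push_cast; nlinarith)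
          push_cast; nlinarith
      _ = 2 * Real.log ((M : ℝ) + 2) := by rw [Real.log_pow]; norm_num
  have hpowC : Real.log ((M : ℝ) + ((M * M : ℕ) : ℝ) + 2) ^ C ≤ 2 ^ C * Real.log ((M : ℝ) + 2) ^ C := by
    calc _ ≤ (2 * Real.log ((M : ℝ) + 2)) ^ C := pow_le_pow_left₀ hlog0 hlog C
      _ = 2 ^ C * Real.log ((M : ℝ) + 2) ^ C := by rw [mul_pow]
  have hrpow0 : 0 ≤ (M : ℝ) ^ (1 - δ) := (Real.rpow_pos_of_pos hMpos _).le
  have hlogM0 : 0 ≤ Real.log ((M : ℝ) + 2) ^ C := pow_nonneg (Real.log_nonneg (by linarith)) C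
  have h2C : (1 : ℝ) ≤ 2 ^ C := one_le_pow₀ (by norm_num)
  have hB : B < min c 1 / 2 * M := by
    have h1 : (M : ℝ) ^ (1 - δ) * Real.log ((M : ℝ) + ((M * M : ℕ) : ℝ) + 2) ^ C
        ≤ 2 ^ C * ((M : ℝ) ^ (1 - δ) * Real.log ((M : ℝ) + 2) ^ C) := by
      calc _ ≤ (M : ℝ) ^ (1 - δ) * (2 ^ C * Real.log ((M : ℝ) + 2) ^ C) :=
            mul_le_mul_of_nonneg_left hpowC hrpow0
        _ = _ := by ring
    have h2 : B ≤ 2 ^ C * ((M : ℝ) ^ (1 - δ) * Real.log ((M : ℝ) + 2) ^ C + C) := by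
      have hC0 : (0 : ℝ) ≤ C := Nat.cast_nonneg C
      rw [hBdef]; nlinarith
    have h3 : (2 : ℝ) ^ C * (min c 1 / 2 ^ (C + 1) * M) = min c 1 / 2 * M := by
      rw [pow_succ]; field_simp
    calc B ≤ _ := h2
      _ < 2 ^ C * (min c 1 / 2 ^ (C + 1) * M) := by
          apply mul_lt_mul_of_pos_left hw (by positivity)
      _ = min c 1 / 2 * M := h3
  have hBM : B < M := by
    have : min c 1 / 2 * (M : ℝ) ≤ 1 / 2 * M :=
      mul_le_mul_of_nonneg_right (by linarith [min_le_right c 1]) hMpos.le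
    linarith
  have hBc : B < c * M := by
    have : min c 1 / 2 * (M : ℝ) ≤ c / 2 * M :=
      mul_le_mul_of_nonneg_right (by linarith [min_le_left c 1]) hMpos.le
    nlinarith
  -- the instance lies in the window
  have hclog : 1 ≤ Nat.clog 2 (M * M + 1) := Nat.clog_pos one_lt_two (by nlinarith)
  have hwin : B < ((min (M * Nat.clog 2 (M * M + 1) + Nat.clog 2 (M * M))
      (M * M + Nat.clog 2 (M * M)) : ℕ) : ℝ) := by
    refine hBM.trans_le ?_
    exact_mod_cast le_min (by nlinarith) (by nlinarith [Nat.zero_le (Nat.clog 2 (M * M))])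
  obtain ⟨P, hP, hPd⟩ := hspec hwin
  -- `P` solves the monotone KW game of `PM_M` in depth `≤ B < c·M`: contradiction with RW92
  have hP' : P.SolvesMono (perfectMatchingFn M) := by
    intro a b ha hb
    have ha' := (shadow_perPoly_iff k a).2 ((perfectMatchingFn_eq_true_iff M a).1 ha)
    have hb' : ¬ ∃ mo ∈ (perPoly (Fin M) k).support, ∀ i ∈ mo.support, b i = true := by
      intro h
      have := (perfectMatchingFn_eq_true_iff M b).2 ((shadow_perPoly_iff k b).1 h)
      rw [this] at hb
      exact Bool.noConfusion hb
    -- the stub's `decide` carries the `Fintype`-based instance; bridge through the propositions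
    refine hP a b ?_ ?_
    · simp only [decide_eq_true_eq]; exact ha'
    · simp only [decide_eq_false_iff_not]; exact hb'
  have hKW := KWTree.formulaSizeOver_le_two_pow_depth P hP'
  have hr := hm₀ M hMm₀
  have h2 : ((formulaSizeOver monotoneBasis (perfectMatchingFn M) : ℕ) : ℝ) ≤
      (2 : ℝ) ^ ((P.depth : ℕ) : ℝ) := by
    rw [Real.rpow_natCast]; exact_mod_cast hKW
  have h3 := hr.trans h2
  rw [Real.rpow_le_rpow_left_iff (by norm_num : (1 : ℝ) < 2)] at h3
  linarith

end Summit.ValiantsHypothesis.ValiantsHypothesis.Theorems.ShadowFormulaTransfer.Negative.FalseOverCharTwo
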